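import Literature.NumberTheory.Irrationality.Hata1993.IrrationalityMeasure
import Summits.KontsevichZagierPeriods.Zeta5Search.MeasureRecords
import Summits.KontsevichZagierPeriods.Zeta5Search.Criteria
import HarnessLib

/-!
# ζ(5) search — criterion C4 WITHOUT non-proportionality, via Hata 1993 (cell `pub-zeta5`, PROVER 3)

HONEST FRAMING: systematic search; no irrationality claim unless certified.

The typer's C4 (`EffectiveMeasure.lean`: `not_liouvilleWith_of_eventual_rates`) needs CONSECUTIVE
non-proportionality `p_r q_{r+1} ≠ p_{r+1} q_r` for all large `r` — automatic for an order-2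
recurrence (Casoratian), but NOT available for the measure lane's families (`families/measure/FAMILY.md`
§0: Rhin–Viola / Zudilin 2014 / Marcovecchio–Zudilin forms obey recurrences of order 3 or none). The
classical way out is Hata's lemma, now PROVED in the tree by the literature seat:
`Literature.NumberTheory.Irrationality.Hata1993.remark_2_1` (Acta Arith. 63 (1993), Remark 2.1): for an
IRRATIONAL `γ` and integers `pₙ, qₙ` with `lim (1/n) log|qₙ| = Q` and `limsup (1/n) log|qₙγ - pₙ| ≤ -σ`
one has `μ(γ) ≤ 1 + Q/σ`, with no non-vanishing or non-proportionality hypothesis at all (the EXISTENCE of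
the limit of `log|qₙ|/n`, i.e. a LOWER growth bound on the coefficients, replaces it). This file is the
Summit-side C4 variant built on it BY NAME (lead/lit g10 request 2026-08-20T19:00Z), in the
`ExponentLE` vocabulary of `MeasureRecords.lean`:

* `ExponentLE.of_hasIrrationalityMeasure` — Hata's `HasIrrationalityMeasure γ μ` gives `ExponentLE γ μ`
  (`= ∀ p > μ, ¬ LiouvilleWith p γ`; tree bridge `HasIrrationalityMeasure.not_liouvilleWith`).
* `ExponentLE.of_hata_rates` — `remark_2_1` verbatim in `ExponentLE` form (two-sided `δ`-rates for
  `|qₙ|`, `δ`-rate decay bound).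
* `ExponentLE.of_tendsto_log_coeff` — the working form for the cell: `ξ ∉ ℚ`,
  `log|qₙ|/n → Q > 0`, `|qₙ ξ - pₙ| ≤ l e^{-σ n}` for large `n` (`σ, l > 0`) ⇒ `μ(ξ) ≤ 1 + Q/σ`
  (via the tree's `Hata1993.rates_of_tendsto_log`).
* `irrational_and_exponentLE_of_tendsto_log_coeff` — the same with irrationality SUPPLIED by the
  elementary criterion (`qₙ ξ - pₙ ≠ 0` infinitely often, `Criteria.irrational_of_int_linear_forms`), so
  that a family delivers `Irrational ξ ∧ ExponentLE ξ (1 + Q/σ)` from: decay bound, coefficient LIMIT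
  rate, non-vanishing infinitely often — exactly the data of a FORMAT B certificate plus the limit
  `log|bₙ|/n → Q` of its integer `ξ`-coefficients.
* `LinearFormCertificate.exponentLE_of_tendsto_log_coeff` — FORMAT B ⇒ `μ(ξ) ≤ 1 + Q/μ₁`
  (`μ₁ = c + φ - δ` the certificate's margin) from the single extra input `log|coeffXi n|/n → Q`;
  `LinearFormCertificate.zetaThree_record_of_tendsto_log_coeff` / `zetaTwo_record_…` — the per-constant
  "beat the record" forms of `MeasureRecords.lean` with this input.

In `CRITERIA.md` units (§0/C4): `Q = b + δ - φ` must here be an exact LIMIT rate of the integer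
coefficients `D_n b_n/Φ_n` (for hypergeometric/RV-type families: the coefficient saddle point is real
and dominant, so the limit exists — a statement each family must PROVE), `σ = μ₁`. Everything is
PROVED (0 sorry, no named fact); nothing here is a certificate.
-/

noncomputable section

open Filter Topology
open Literature.NumberTheory.Transcendental
open Literature.NumberTheory.Irrationality
open Literature.NumberTheory.Irrationality.Hata1993

namespace Summit.KontsevichZagierPeriods.Zeta5Search

namespace ExponentLE

variable {ξ : ℝ}

/-- Hata's `HasIrrationalityMeasure ξ μ` (|ξ - p/q| ≥ q^{-μ-ε} for `q ≥ q₀(ε)`) gives `μ(ξ) ≤ μ` in the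
`LiouvilleWith` rendering (tree: `HasIrrationalityMeasure.not_liouvilleWith`). -/
theorem of_hasIrrationalityMeasure {μ : ℝ} (h : HasIrrationalityMeasure ξ μ) : ExponentLE ξ μ :=
  fun _ hp => h.not_liouvilleWith hp

/-- **C4 without non-proportionality (Hata 1993, Remark 2.1, tree theorem `Hata1993.remark_2_1`).**
`ξ` irrational, integers `pₙ, qₙ` with `e^{(Q-δ)n} ≤ |qₙ| ≤ e^{(Q+δ)n}` and `|qₙξ - pₙ| ≤ e^{-(σ-δ)n}`
for all large `n`, for every `δ > 0` (`Q, σ > 0`): then `μ(ξ) ≤ 1 + Q/σ`. (Cell units: `Q` = coefficient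
rate, `σ` = decay rate of the integer forms; Hata writes `σ, τ` for our `Q, σ`.) -/
theorem of_hata_rates {Q σ : ℝ} (hξ : Irrational ξ) (hQ : 0 < Q) (hσ : 0 < σ) (p q : ℕ → ℤ)
    (hq : ∀ δ : ℝ, 0 < δ → ∀ᶠ n : ℕ in atTop,
      Real.exp ((Q - δ) * n) ≤ |(q n : ℝ)| ∧ |(q n : ℝ)| ≤ Real.exp ((Q + δ) * n))
    (herr : ∀ δ : ℝ, 0 < δ → ∀ᶠ n : ℕ in atTop,
      |(q n : ℝ) * ξ - p n| ≤ Real.exp (-((σ - δ) * n))) :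
    ExponentLE ξ (1 + Q / σ) :=
  of_hasIrrationalityMeasure (remark_2_1 hξ hQ hσ p q hq herr)

/-- **The working form.** `ξ` irrational, `log|qₙ|/n → Q > 0` (an exact LIMIT rate of the integer
coefficients) and `|qₙξ - pₙ| ≤ l e^{-σ n}` for all large `n` (`σ, l > 0`): then `μ(ξ) ≤ 1 + Q/σ` — no
non-vanishing or non-proportionality hypothesis (tree: `Hata1993.rates_of_tendsto_log` + `remark_2_1`). -/
theorem of_tendsto_log_coeff {Q σ l : ℝ} (hξ : Irrational ξ) (hQ : 0 < Q) (hσ : 0 < σ) (hl : 0 < l)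
    (p q : ℕ → ℤ)
    (hq : Tendsto (fun n : ℕ => Real.log |(q n : ℝ)| / n) atTop (𝓝 Q))
    (herr : ∀ᶠ n : ℕ in atTop, |(q n : ℝ) * ξ - p n| ≤ l * Real.exp (-(σ * n))) :
    ExponentLE ξ (1 + Q / σ) := by
  refine of_hata_rates hξ hQ hσ p q (rates_of_tendsto_log hQ hq) fun δ hδ => ?_
  -- `l e^{-σ n} ≤ e^{-(σ-δ) n}` as soon as `log l ≤ δ n`
  have hev : ∀ᶠ n : ℕ in atTop, Real.log l ≤ δ * n := by
    have ht : Tendsto (fun n : ℕ => δ * (n : ℝ)) atTop atTop :=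
      tendsto_natCast_atTop_atTop.const_mul_atTop hδ
    exact ht.eventually_ge_atTop (Real.log l)
  filter_upwards [herr, hev] with n hn hlog
  refine hn.trans ?_
  have e : l * Real.exp (-(σ * n)) = Real.exp (Real.log l + -(σ * n)) := by
    rw [Real.exp_add, Real.exp_log hl]
  rw [e, Real.exp_le_exp]
  linarith

end ExponentLE

/-- **Irrationality AND the exponent from one data set.** Integers `pₙ, qₙ` with `qₙξ - pₙ ≠ 0` for
infinitely many `n`, `|qₙξ - pₙ| ≤ l e^{-σ n}` for all large `n` (`σ, l > 0`) and `log|qₙ|/n → Q > 0`: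
then `ξ ∉ ℚ` (elementary criterion `Criteria.irrational_of_int_linear_forms`) and `μ(ξ) ≤ 1 + Q/σ`
(Hata). This is the shape of a FORMAT B family read for a measure: decay, non-vanishing infinitely
often, and the LIMIT rate of its integer coefficients. -/
theorem irrational_and_exponentLE_of_tendsto_log_coeff {ξ Q σ l : ℝ} (hQ : 0 < Q) (hσ : 0 < σ)
    (hl : 0 < l) (p q : ℕ → ℤ)
    (hq : Tendsto (fun n : ℕ => Real.log |(q n : ℝ)| / n) atTop (𝓝 Q))
    (herr : ∀ᶠ n : ℕ in atTop, |(q n : ℝ) * ξ - p n| ≤ l * Real.exp (-(σ * n)))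
    (hne : ∃ᶠ n : ℕ in atTop, (q n : ℝ) * ξ - p n ≠ 0) :
    Irrational ξ ∧ ExponentLE ξ (1 + Q / σ) := by
  have hξ : Irrational ξ := by
    refine irrational_of_int_linear_forms (fun n => -p n) q ?_ ?_
    · -- `|(-pₙ) + qₙ ξ| ≤ l e^{-σ n} → 0`
      have h0 : Tendsto (fun n : ℕ => l * Real.exp (-(σ * n))) atTop (𝓝 0) := by
        have h1 : Tendsto (fun n : ℕ => Real.exp (-(σ * n))) atTop (𝓝 0) := by
          refine Real.tendsto_exp_atBot.comp ?_
          have h2 : Tendsto (fun n : ℕ => σ * (n : ℝ)) atTop atTop :=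
            tendsto_natCast_atTop_atTop.const_mul_atTop hσ
          exact tendsto_neg_atTop_atBot.comp h2
        simpa using h1.const_mul l
      refine squeeze_zero_norm' ?_ h0
      filter_upwards [herr] with n hn
      rw [Real.norm_eq_abs]
      have e : ((-p n : ℤ) : ℝ) + q n * ξ = (q n : ℝ) * ξ - p n := by push_cast; ring
      rw [e]
      exact hn
    · refine hne.mono fun n hn => ?_
      have e : ((-p n : ℤ) : ℝ) + q n * ξ = (q n : ℝ) * ξ - p n := by push_cast; ring
      rw [e]
      exact hn
  exact ⟨hξ, ExponentLE.of_tendsto_log_coeff hξ hQ hσ hl p q hq herr⟩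

/-! ### FORMAT B ⇒ exponent, from the limit rate of the integer coefficients -/

namespace LinearFormCertificate

variable {ξ : ℝ} (cert : LinearFormCertificate ξ)

/-- **FORMAT B ⇒ `μ(ξ) ≤ 1 + Q/μ₁` without non-proportionality.** A linear-form certificate (integer
forms `aₙ + bₙ ξ = Dₙ ℓₙ/Φₙ` of size `≤ e^{-μ₁ n}`, `μ₁ = c + φ - δ` its margin) together with the LIMIT rate
`log|bₙ|/n → Q > 0` of the integer `ξ`-coefficients gives `μ(ξ) ≤ 1 + Q/μ₁` (Hata's lemma; the
certificate itself supplies `ξ ∉ ℚ`). -/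
theorem exponentLE_of_tendsto_log_coeff {Q : ℝ} (hQ : 0 < Q)
    (hcoeff : Tendsto (fun n : ℕ => Real.log |(cert.coeffXi n : ℝ)| / n) atTop (𝓝 Q)) :
    ExponentLE ξ (1 + Q / cert.margin) := by
  refine ExponentLE.of_tendsto_log_coeff cert.irrational hQ cert.margin_pos' one_pos
    (fun n => -cert.coeffConst n) cert.coeffXi hcoeff ?_
  filter_upwards [cert.eventually_abs_scaled_le, cert.arith] with n hn harith
  have hΦ : (cert.saving n : ℝ) ≠ 0 := by exact_mod_cast (cert.saving_pos n).ne'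
  have e : (cert.coeffXi n : ℝ) * ξ - ((-cert.coeffConst n : ℤ) : ℝ) =
      (cert.denom n : ℝ) * cert.form n / cert.saving n := by
    rw [harith, mul_div_cancel_left₀ _ hΦ]
    push_cast
    ring
  rw [e, one_mul]
  exact hn

/-- **`ζ(3)`: beating Rhin–Viola with a FORMAT B certificate and a coefficient limit rate.** If
`1 + Q/μ₁ < 5.513891` the certificate proves the tree's Rhin–Viola record fact and the new bound
(`MeasureRecords.zetaThree_record_of_exponentLE`). Implication only. -/
theorem zetaThree_record_of_tendsto_log_coeff (cert : LinearFormCertificate (zetaValue 3)) {Q : ℝ}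
    (hQ : 0 < Q)
    (hcoeff : Tendsto (fun n : ℕ => Real.log |(cert.coeffXi n : ℝ)| / n) atTop (𝓝 Q))
    (hκ : 1 + Q / cert.margin < 5.513891) :
    RhinViola2001.zetaThree_irrationalityExponent_lt ∧
      ExponentLE (zetaValue 3) (1 + Q / cert.margin) :=
  ⟨(zetaThree_record_of_exponentLE (cert.exponentLE_of_tendsto_log_coeff hQ hcoeff) hκ).1,
    cert.exponentLE_of_tendsto_log_coeff hQ hcoeff⟩

/-- **`ζ(2)`: beating Zudilin 2014 with a FORMAT B certificate and a coefficient limit rate.** If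
`1 + Q/μ₁ < 5.09541179` the certificate proves the tree's Zudilin 2014 record fact and the new bound.
Implication only. -/
theorem zetaTwo_record_of_tendsto_log_coeff (cert : LinearFormCertificate (zetaValue 2)) {Q : ℝ}
    (hQ : 0 < Q)
    (hcoeff : Tendsto (fun n : ℕ => Real.log |(cert.coeffXi n : ℝ)| / n) atTop (𝓝 Q))
    (hκ : 1 + Q / cert.margin < 5.09541179) :
    Zudilin2014.zetaTwo_irrationalityExponent_le ∧
      ExponentLE (zetaValue 2) (1 + Q / cert.margin) :=
  ⟨(zetaTwo_record_of_exponentLE (cert.exponentLE_of_tendsto_log_coeff hQ hcoeff) hκ).1,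
    cert.exponentLE_of_tendsto_log_coeff hQ hcoeff⟩

end LinearFormCertificate

end Summit.KontsevichZagierPeriods.Zeta5Search
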